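import Literature.RepresentationTheory.FiniteGroups.GL2ModularPrincipalSeriesBruhatBasis
import Literature.NumberTheory.Automorphic.TwistedQuotientRestrictScalars
import HarnessLib

/-!
# Reduction of the coefficient ring of the principal series `Fun_R(Ind(χ₁ ⊗ χ₂)) → Fun_k(Ind(χ̄₁ ⊗ χ̄₂))`

Topic `Literature/RepresentationTheory/FiniteGroups`, namespace `Literature.RepresentationTheory.FiniteGroups.GL2`.
DEFINITIONS + API (reviewed kind); no named fact, no instance, no notation, no `sorry`.

For an `R`-algebra `k` (structure map `R → k`, e.g. `ℤ_p → 𝔽_p`) and characters `χ₁ χ₂ : Fˣ → Rˣ` with reductions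
`χ̄ᵢ = (R → k) ∘ χᵢ` (`reduceChar`), pointwise reduction of functions is an `R`-linear `GL₂(F)`-equivariant map
`Fun_R(Ind_B^{GL₂(F)}(χ₁ ⊗ χ₂)) → Fun_k(Ind(χ̄₁ ⊗ χ̄₂))` (`reduce`, an intertwining map into the restriction of
scalars `TwistedQuotient.resScalars R` of the `k`-valued principal series).  This is the reduction map
`L ↦ L/ϖL = L ⊗ k` of a `GL₂(F)`-stable lattice in the sense of [SerreLinearRepresentations1977, §15.2] /
[EmertonGeeSavitt2015, §4.1] for the STANDARD lattice `L₀ = Fun_R(Ind)` of a tame principal-series type, made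
explicit in the function model:

* `bruhatEval_reduce` — reduction commutes with the Bruhat coordinates of `GL2ModularPrincipalSeriesBruhatBasis`;
* **`exists_eq_smul_of_forall_dvd`** / **`reduce_eq_zero_iff`** — if `ker(R → k) = (ϖ)` then
  `ker(reduce) = ϖ · Fun_R(Ind(χ₁ ⊗ χ₂))` (divide the `#F + 1` Bruhat coordinates by `ϖ`; no regularity of `ϖ` is
  needed);
* **`reduce_surjective`** — if `R → k` is onto, so is the reduction (lift the Bruhat coordinates).

Hence `Fun_R(Ind(χ₁ ⊗ χ₂)) / ϖ ≅ Fun_k(Ind(χ̄₁ ⊗ χ̄₂))` equivariantly — the input «`L̄₀` is the mod-`p` principal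
series» of the lattice argument for tame types (sequel: the EGS Lemma 4.1.1 application).
-/

noncomputable section

namespace Literature.RepresentationTheory.FiniteGroups

namespace GL2

open Matrix

/-! ## Reduction of the coefficient ring along an algebra `R → k` -/
section Reduction

variable {F : Type} [Field F] [DecidableEq F] {R : Type} [CommRing R] {k : Type} [CommRing k] [Algebra R k]
  (χ₁ χ₂ : Fˣ →* Rˣ)

variable (k) in
/-- The reduction `χ̄ = (R → k) ∘ χ` of an `R`-valued character along the structure map of an `R`-algebra `k`. [cite: SerreLinearRepresentations1977, §15.2] -/
def reduceChar (χ : Fˣ →* Rˣ) : Fˣ →* kˣ :=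
  (Units.map (algebraMap R k : R →* k)).comp χ

omit [DecidableEq F] in
/-- Value of the reduced character. [cite: SerreLinearRepresentations1977, §15.2] -/
@[simp]
theorem coe_reduceChar_apply (χ : Fˣ →* Rˣ) (a : Fˣ) :
    (reduceChar k χ a : k) = algebraMap R k (χ a : R) := rfl

omit [DecidableEq F] in
/-- `χ̄(b) = (R → k)(χ(b))` for the Borel character. [cite: SerreLinearRepresentations1977, §15.2] -/
theorem coe_borelCharacter_reduceChar (b : borel F) :
    (borelCharacter F (reduceChar k χ₁) (reduceChar k χ₂) b : k) =
      algebraMap R k (borelCharacter F χ₁ χ₂ b : R) := by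
  rw [borelCharacter_apply, borelCharacter_apply, Units.val_mul, Units.val_mul, map_mul,
    coe_reduceChar_apply, coe_reduceChar_apply]

omit [DecidableEq F] in
/-- Pointwise reduction of a function of `Fun_R(Ind(χ₁ ⊗ χ₂))` is a function of `Fun_k(Ind(χ̄₁ ⊗ χ̄₂))`. [cite: SerreLinearRepresentations1977, §15.2] -/
theorem reduce_mem (f : Representation.coindV (borel F).subtype (scalarRep (borelCharacter F χ₁ χ₂))) :
    (fun x => algebraMap R k ((f : GL (Fin 2) F → R) x)) ∈
      Representation.coindV (borel F).subtype
        (scalarRep (borelCharacter F (reduceChar k χ₁) (reduceChar k χ₂))) := by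
  rw [mem_principalSeriesRep_iff]
  intro b x
  rw [apply_borel_mul χ₁ χ₂ f b x, map_mul, coe_borelCharacter_reduceChar]

variable (k) in
/-- **Reduction of the coefficients** `Fun_R(Ind(χ₁ ⊗ χ₂)) → Fun_k(Ind(χ̄₁ ⊗ χ̄₂))`, `f ↦ (R → k) ∘ f`, as an
`R`-linear `GL₂(F)`-equivariant map (an intertwining map into the restriction of scalars of the
`k`-valued principal series). [cite: SerreLinearRepresentations1977, §15.2] -/
def reduce :
    (principalSeriesRep F χ₁ χ₂).IntertwiningMap
      (Literature.NumberTheory.Automorphic.TwistedQuotient.resScalars R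
        (principalSeriesRep F (reduceChar k χ₁) (reduceChar k χ₂))) where
  toFun f := ⟨fun x => algebraMap R k ((f : GL (Fin 2) F → R) x), reduce_mem χ₁ χ₂ f⟩
  map_add' f g := by
    refine Subtype.ext (funext fun x => ?_)
    simp only [Submodule.coe_add, Pi.add_apply, map_add]
  map_smul' c f := by
    refine Subtype.ext (funext fun x => ?_)
    simp only [Submodule.coe_smul, Pi.smul_apply, smul_eq_mul, map_mul, RingHom.id_apply,
      Submodule.coe_smul_of_tower, Algebra.smul_def]
  isIntertwining' g := by
    refine LinearMap.ext fun f => Subtype.ext (funext fun x => ?_)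
    rfl

omit [DecidableEq F] in
/-- Value of the reduced function. [cite: SerreLinearRepresentations1977, §15.2] -/
@[simp]
theorem coe_reduce_apply (f : Representation.coindV (borel F).subtype (scalarRep (borelCharacter F χ₁ χ₂)))
    (x : GL (Fin 2) F) :
    ((reduce k χ₁ χ₂ f : Representation.coindV (borel F).subtype
        (scalarRep (borelCharacter F (reduceChar k χ₁) (reduceChar k χ₂)))) : GL (Fin 2) F → k) x =
      algebraMap R k ((f : GL (Fin 2) F → R) x) := rfl

omit [DecidableEq F] in
/-- Reduction commutes with the Bruhat coordinates. [cite: SerreLinearRepresentations1977, §15.2] -/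
theorem bruhatEval_reduce (f : Representation.coindV (borel F).subtype (scalarRep (borelCharacter F χ₁ χ₂)))
    (o : Option F) :
    bruhatEval (reduceChar k χ₁) (reduceChar k χ₂) (reduce k χ₁ χ₂ f) o = algebraMap R k (bruhatEval χ₁ χ₂ f o) := by
  cases o <;> rfl

/-- **Kernel of the reduction**: a function all of whose values are divisible by `ϖ` is `ϖ` times a
function of the principal series (no regularity of `ϖ` needed: divide the Bruhat coordinates). [cite: SerreLinearRepresentations1977, §15.2] -/
theorem exists_eq_smul_of_forall_dvd {ϖ : R}
    (f : Representation.coindV (borel F).subtype (scalarRep (borelCharacter F χ₁ χ₂)))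
    (h : ∀ x : GL (Fin 2) F, ϖ ∣ (f : GL (Fin 2) F → R) x) :
    ∃ g : Representation.coindV (borel F).subtype (scalarRep (borelCharacter F χ₁ χ₂)), f = ϖ • g := by
  choose ψ hψ using fun o : Option F => h (Option.elim o 1 fun t => weyl F * upperUnip F t)
  refine ⟨(bruhatEquiv χ₁ χ₂).symm ψ, ?_⟩
  rw [← LinearEquiv.map_smul, ← (bruhatEquiv χ₁ χ₂).symm_apply_apply f]
  congr 1
  funext o
  cases o with
  | none => simpa using hψ none
  | some t => simpa using hψ (some t)

/-- Membership in the kernel of the reduction, when `ker (R → k) = (ϖ)`. [cite: SerreLinearRepresentations1977, §15.2] -/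
theorem reduce_eq_zero_iff {ϖ : R} (hker : ∀ a : R, algebraMap R k a = 0 ↔ ϖ ∣ a)
    (f : Representation.coindV (borel F).subtype (scalarRep (borelCharacter F χ₁ χ₂))) :
    reduce k χ₁ χ₂ f = 0 ↔
      ∃ g : Representation.coindV (borel F).subtype (scalarRep (borelCharacter F χ₁ χ₂)), f = ϖ • g := by
  constructor
  · intro h0
    refine exists_eq_smul_of_forall_dvd χ₁ χ₂ f fun x => (hker _).mp ?_
    have := congrArg (fun u => ((u : Representation.coindV (borel F).subtype
        (scalarRep (borelCharacter F (reduceChar k χ₁) (reduceChar k χ₂)))) : GL (Fin 2) F → k) x) h0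
    simpa using this
  · rintro ⟨g, rfl⟩
    refine Subtype.ext (funext fun x => ?_)
    rw [coe_reduce_apply]
    simp only [Submodule.coe_smul_of_tower, Pi.smul_apply, smul_eq_mul, map_mul, (hker ϖ).mpr (dvd_refl ϖ),
      zero_mul]
    rfl

/-- **The reduction is surjective** when `R → k` is. [cite: SerreLinearRepresentations1977, §15.2] -/
theorem reduce_surjective (hsurj : Function.Surjective (algebraMap R k)) :
    Function.Surjective (reduce k χ₁ χ₂) := by
  intro φ
  choose ψ hψ using fun o : Option F => hsurj (bruhatEval (reduceChar k χ₁) (reduceChar k χ₂) φ o)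
  refine ⟨bruhatLift χ₁ χ₂ ψ, ?_⟩
  apply (bruhatEquiv (reduceChar k χ₁) (reduceChar k χ₂)).injective
  funext o
  rw [bruhatEquiv_apply, bruhatEquiv_apply, bruhatEval_reduce, ← bruhatEquiv_apply, ← bruhatEquiv_symm_apply,
    LinearEquiv.apply_symm_apply, hψ]

end Reduction

end GL2

end Literature.RepresentationTheory.FiniteGroups
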